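import Summits.CriticalPhenomena.PercolationContinuityZ3.Theorems.Transplant.FKConnectivityAllQExchange
import HarnessLib

/-!
# Connectivity correlation inequalities for `φ_{w,q}`, every `q > 0` — the FAR exchange inequality (node) and the STAR exchange
# inequality (node, product situation) together imply MM; the far form survives the arboreal regime that refutes K₀ at the root

Support file (`--supports stmt-CriticalPhenomena-4575`), FK sub-lane `prim-bschramm-fk-1` (gen 8) of the post-continuity
programme; builds on p205010 (kernel theorem, internal audit signed; external expert review pending).  Definitions (`exchIneq`,
`ExchangeFarOn/FK`, `ExchangeStarOn/FK`, two `@[conjecture]` nodes — NOT asserted), no named facts, no sorries; standard axioms.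

CONTEXT.  `…Exchange.lean` proved K₀ ⇒ MM, where K₀ is the exchange inequality `Z₁₀Z₀₁(u₀₁−u₁₀) ≤ Z₁₁Z₀₀(u₁₁−u₀₀)` for the compared
pair `f = xz` and a second pair `g` AT the weight-1 cluster `W` of `x`; `…ExchangeCex.lean` REFUTED K₀ for small `q` (the mixed
coefficient of `W_f` in an activity AT the root can be negative in the arboreal regime).  The two-pair expansion is valid for ANY second
pair, and the induction can be run on the pairs AWAY from `W` first:
* (FAR, `ExchangeFarOn`) the exchange inequality for `g` DISJOINT from `W` — exact census: 0 violations in 2,173,150 exhaustive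
  instances on `≤ 6` vertices (`q ∈ {1/10,1/2,9/10,1,2}`, all up-sets, kit j120363–66), 0/8,000 random `n ≤ 8`, 0/800 sampled along the
  arboreal rays `p = λq` down to `q = 1/1000` — BUT NOT UNIVERSALLY TRUE: its `q ↓ 0` limit (an inequality between weighted spanning-forest
  counts) fails in 1 of 3,450 sampled instances on `≤ 7` vertices (kit j122543), and the FK form fails on that 5-vertex instance at
  `q = 1/100`: **`not_exchangeFarFKPos`** (`…ExchangeFarCex.lean`, updated 2026-08-21T09:20Z).  For `q ≥ 1` FAR is a theorem
  (`…ExchangeFarOneLe.lean`);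
* (STAR, `ExchangeStarOn`) the exchange inequality for an arbitrary `g` when EVERY undetermined pair of `w[f↦0]` meets `W` — then the
  configuration off `W` is a fixed set of blocks to which `W` attaches independently (probability `(Y_K − 1)/(Y_K − 1 + q)` for a block
  reached by pairs of total odds-product `Y_K`), the four partition functions factor, and the inequality reduces to `u₁₁ + u₁₀ ≥ u₀₁ + u₀₀`
  (proof on paper, bschramm/FROM-fk-1-g8-EXCHANGE.md §8; recorded here as a node so that the reduction below is unconditional in form).
THEOREM `clusterDomAdjOn_of_exchangeFar_star`: FAR ∧ STAR ⇒ MM (induction on the undetermined pairs of `w[f↦0]`: split along a pair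
disjoint from `W` while one exists (FAR), then along the pairs meeting `W` (STAR), base = deterministic cluster), hence ⇒ CA, the hub
inequality, adjacent-edge negative correlation — a valid reduction whose FAR hypothesis is, like K₀ at the root, false for small `q` on
some graphs; so 'MM coefficientwise in ONE activity' fails in both the root and the far form, while MM itself (the discriminant condition
`b ≥ −2√(ac)` per activity) is clean in every census, as is its forest limit (0/4,400).
[cite: Grimmett2006, Thm. (3.7) (p. 39); §3.9 (pp. 63–65)] [cite: AyyerLinussonRavichandran2025, §7 eq. (13)–(15), Conj. 7.1 (p. 22)]
[cite: Wagner2006, Conj. 5.3 (p. 13)]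
-/

noncomputable section

namespace Summit.CriticalPhenomena.PercolationContinuityZ3.Theorems

namespace FK

open MeasureTheory Set Literature.Probability.LatticeModels Literature.Probability.Percolation
open scoped Classical
open BHK2006 DecisionTree HullPort

variable {V : Type*} [Fintype V]

/-! ### The exchange inequality as a predicate of `(w, x, z, g, 𝒰)` -/

/-- **The exchange inequality** for the compared pair `f = xz`, the second pair `g` and the up-set `𝒰`:
`Z₁₀·Z₀₁·(u₀₁ − u₁₀) ≤ Z₁₁·Z₀₀·(u₁₁ − u₀₀)` with `w_{ab} = w[xz ↦ a][g ↦ b]`, `Z_{ab} = Z(w_{ab})`, `u_{ab} = φ_{w_{ab},q}(C_x ∈ 𝒰)`.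
[cite: Grimmett2006, Thm. (3.7) (p. 39)] -/
def exchIneq (w : Sym2 V → unitInterval) (q : ℝ) (x z : V) (g : Sym2 V) (𝒰 : Set (Set V)) : Prop :=
  rcPartitionFunctionW (Function.update (Function.update w s(x, z) 1) g 0) q ∅ *
      rcPartitionFunctionW (Function.update (Function.update w s(x, z) 0) g 1) q ∅ *
      ((rcMeasureW (Function.update (Function.update w s(x, z) 0) g 1) q ∅).real (clusterIn x 𝒰) -
        (rcMeasureW (Function.update (Function.update w s(x, z) 1) g 0) q ∅).real (clusterIn x 𝒰)) ≤
    rcPartitionFunctionW (Function.update (Function.update w s(x, z) 1) g 1) q ∅ *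
      rcPartitionFunctionW (Function.update (Function.update w s(x, z) 0) g 0) q ∅ *
      ((rcMeasureW (Function.update (Function.update w s(x, z) 1) g 1) q ∅).real (clusterIn x 𝒰) -
        (rcMeasureW (Function.update (Function.update w s(x, z) 0) g 0) q ∅).real (clusterIn x 𝒰))

/-- **FAR exchange inequality on `V`**: `exchIneq` for every second pair `g` none of whose endpoints is joined to `x` by parameter-1
pairs of `w[xz ↦ 0]` (i.e. `g` is disjoint from the weight-1 cluster of `x`).  For `q ≥ 1` a theorem (`exchangeFarOn_of_one_le`);
for small `q` false on some graphs (`not_exchangeFarFKPos`). [cite: Grimmett2006, §3.9 (p. 63)] -/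
def ExchangeFarOn (V : Type*) [Fintype V] (q : ℝ) : Prop :=
  ∀ (w : Sym2 V → unitInterval) (x z : V) (g : Sym2 V) (𝒰 : Set (Set V)), IsUpperSet 𝒰 →
    (∀ y ∈ g, ¬ (openGraph (oneSet (Function.update w s(x, z) 0))).Reachable x y) → exchIneq w q x z g 𝒰

/-- **STAR exchange inequality on `V`**: `exchIneq` for an arbitrary second pair `g` in the PRODUCT SITUATION where every undetermined pair
of `w[xz ↦ 0]` meets the weight-1 cluster of `x` (the configuration away from the cluster is deterministic; block attachments are
independent).  True on paper for every `q > 0` (memo §8); recorded as a node pending its kernel proof. [cite: Grimmett2006, Thm. (3.7) (p. 39)] -/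
def ExchangeStarOn (V : Type*) [Fintype V] (q : ℝ) : Prop :=
  ∀ (w : Sym2 V → unitInterval) (x z : V) (g : Sym2 V) (𝒰 : Set (Set V)), IsUpperSet 𝒰 →
    (∀ h ∈ undet (Function.update w s(x, z) 0), ∃ y ∈ h, (openGraph (oneSet (Function.update w s(x, z) 0))).Reachable x y) →
    g ∈ undet (Function.update w s(x, z) 0) → exchIneq w q x z g 𝒰

/-- FAR on every `Fin n`. [cite: Grimmett2006, §3.9 (p. 63)] -/
def ExchangeFarFK (q : ℝ) : Prop := ∀ n : ℕ, ExchangeFarOn (Fin n) q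

/-- STAR on every `Fin n`. [cite: Grimmett2006, Thm. (3.7) (p. 39)] -/
def ExchangeStarFK (q : ℝ) : Prop := ∀ n : ℕ, ExchangeStarOn (Fin n) q

/-- **FAR exchange inequality for every `q > 0`.**  CONJECTURE-SHAPED STATEMENT, NOT asserted — REFUTED for small `q`
(`not_exchangeFarFKPos`, `…ExchangeFarCex.lean`); true for `q ≥ 1` (`…ExchangeFarOneLe.lean`); kept as the named hypothesis of
`clusterDomAdjFKPos_of_exchangeFar_star`. [cite: Grimmett2006, §3.9 (pp. 63–65)] [cite: AyyerLinussonRavichandran2025, §7 Conj. 7.1 (p. 22)] -/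
@[conjecture] def ExchangeFarFKPos : Prop := ∀ q : ℝ, 0 < q → ExchangeFarFK q

/-- **STAR exchange inequality for every `q > 0`.**  CONJECTURE-SHAPED STATEMENT (provable: product situation), NOT asserted here.
[cite: Grimmett2006, Thm. (3.7) (p. 39)] -/
@[conjecture] def ExchangeStarFKPos : Prop := ∀ q : ℝ, 0 < q → ExchangeStarFK q

/-- K₀ at the root (`ExchangeAdjOn`) implies the STAR form (the star hypothesis is not even needed). [folklore] -/
theorem exchangeStarOn_of_exchangeAdjOn {q : ℝ} (hK : ExchangeAdjOn V q) : ExchangeStarOn V q := by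
  intro w x z g 𝒰 h𝒰 hstar hg
  obtain ⟨y, hyg, hxy⟩ := hstar g hg
  have hg' : g = s(y, Sym2.Mem.other hyg) := (Sym2.other_spec hyg).symm
  unfold exchIneq
  rw [hg']
  exact hK w x z y (Sym2.Mem.other hyg) 𝒰 h𝒰 hxy

/-! ### FAR ∧ STAR ⇒ MM -/

/-- **The two-pair step**: if `g` is an undetermined pair of `w[f↦0]`, MM holds for `w[g↦1]` and `w[g↦0]`, and the exchange
inequality holds for `(f, g)`, then MM holds for `w` (at `f = xz`, up-set `𝒰`). [cite: Grimmett2006, Thm. (3.7) (p. 39)] -/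
theorem mm_of_exchIneq {q : ℝ} (hq0 : 0 < q) (w : Sym2 V → unitInterval) (x z : V) (g : Sym2 V) (𝒰 : Set (Set V))
    (hgu : g ∈ undet (Function.update w s(x, z) 0))
    (ih1 : (rcMeasureW (Function.update (Function.update w g 1) s(x, z) 0) q ∅).real (clusterIn x 𝒰) ≤
      (rcMeasureW (Function.update (Function.update w g 1) s(x, z) 1) q ∅).real (clusterIn x 𝒰))
    (ih0 : (rcMeasureW (Function.update (Function.update w g 0) s(x, z) 0) q ∅).real (clusterIn x 𝒰) ≤
      (rcMeasureW (Function.update (Function.update w g 0) s(x, z) 1) q ∅).real (clusterIn x 𝒰))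
    (hK : exchIneq w q x z g 𝒰) :
    (rcMeasureW (Function.update w s(x, z) 0) q ∅).real (clusterIn x 𝒰) ≤
      (rcMeasureW (Function.update w s(x, z) 1) q ∅).real (clusterIn x 𝒰) := by
  have hgf : g ≠ s(x, z) := by
    intro h
    rw [mem_undet_iff] at hgu
    apply hgu; left; rw [h]; simp
  have comm : ∀ (a c : unitInterval),
      Function.update (Function.update w g c) s(x, z) a = Function.update (Function.update w s(x, z) a) g c :=
    fun a c => Function.update_comm hgf c a w
  rw [comm, comm] at ih1 ih0
  unfold exchIneq at hK
  have hp0 : 0 ≤ (w g : ℝ) := (w g).2.1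
  have hp1 : (w g : ℝ) ≤ 1 := (w g).2.2
  have e0 := mass_split (Function.update w s(x, z) 0) hq0 g (clusterIn x 𝒰)
  have e1 := mass_split (Function.update w s(x, z) 1) hq0 g (clusterIn x 𝒰)
  have d0 := partition_split (Function.update w s(x, z) 0) hq0 g
  have d1 := partition_split (Function.update w s(x, z) 1) hq0 g
  have hwg0 : ((Function.update w s(x, z) 0 g : unitInterval) : ℝ) = w g := by rw [Function.update_of_ne hgf]
  have hwg1 : ((Function.update w s(x, z) 1 g : unitInterval) : ℝ) = w g := by rw [Function.update_of_ne hgf]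
  rw [hwg0] at e0 d0
  rw [hwg1] at e1 d1
  have hZ0 := rcPartitionFunctionW_pos (Function.update w s(x, z) 0) hq0 (∅ : Set V)
  have hZ1 := rcPartitionFunctionW_pos (Function.update w s(x, z) 1) hq0 (∅ : Set V)
  have step := mm_step hp0 hp1
    (rcPartitionFunctionW_pos (Function.update (Function.update w s(x, z) 1) g 1) hq0 (∅ : Set V)).le
    (rcPartitionFunctionW_pos (Function.update (Function.update w s(x, z) 1) g 0) hq0 (∅ : Set V)).le
    (rcPartitionFunctionW_pos (Function.update (Function.update w s(x, z) 0) g 1) hq0 (∅ : Set V)).le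
    (rcPartitionFunctionW_pos (Function.update (Function.update w s(x, z) 0) g 0) hq0 (∅ : Set V)).le
    ih1 ih0 hK
  have key : (rcPartitionFunctionW (Function.update w s(x, z) 0) q ∅ *
        (rcMeasureW (Function.update w s(x, z) 0) q ∅).real (clusterIn x 𝒰)) *
        rcPartitionFunctionW (Function.update w s(x, z) 1) q ∅ ≤
      (rcPartitionFunctionW (Function.update w s(x, z) 1) q ∅ *
        (rcMeasureW (Function.update w s(x, z) 1) q ∅).real (clusterIn x 𝒰)) *
        rcPartitionFunctionW (Function.update w s(x, z) 0) q ∅ := by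
    rw [e0, e1]
    conv_lhs => rw [d1]
    conv_rhs => rw [d0]
    exact step
  refine le_of_mul_le_mul_left ?_ (mul_pos hZ0 hZ1)
  nlinarith [key]

/-- Revealing an undetermined pair of `w[f ↦ 0]` lowers the count of undetermined pairs. [folklore] -/
theorem card_undet_reveal_lt (w : Sym2 V → unitInterval) (x z : V) {g : Sym2 V}
    (hgu : g ∈ undet (Function.update w s(x, z) 0)) (c : unitInterval) (hc : c = 0 ∨ c = 1) :
    (undet (Function.update (Function.update w g c) s(x, z) 0)).card < (undet (Function.update w s(x, z) 0)).card := by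
  have hgf : g ≠ s(x, z) := by
    intro h
    rw [mem_undet_iff] at hgu
    apply hgu; left; rw [h]; simp
  rw [Function.update_comm hgf c 0 w]
  have hsub : undet (Function.update (Function.update w s(x, z) 0) g c) ⊆ (undet (Function.update w s(x, z) 0)).erase g := by
    intro e he
    rw [mem_undet_iff] at he
    rw [Finset.mem_erase, mem_undet_iff]
    by_cases h : e = g
    · subst h; simp only [Function.update_self] at he; exact absurd hc he
    · rw [Function.update_of_ne h] at he; exact ⟨h, he⟩
  have h1 := Finset.card_le_card hsub
  rw [Finset.card_erase_of_mem hgu] at h1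
  have hpos : 0 < (undet (Function.update w s(x, z) 0)).card := Finset.card_pos.2 ⟨g, hgu⟩
  omega

/-- **FAR ∧ STAR ⇒ MM, inductive form** (induction on the undetermined pairs of `w[f ↦ 0]`: far pairs first, then the star phase,
then the deterministic base). [cite: Grimmett2006, Thm. (3.7) (p. 39); §3.9 (pp. 63–65)] -/
theorem clusterDomAdj_of_exchangeFar_star_aux {q : ℝ} (hq0 : 0 < q) (hF : ExchangeFarOn V q) (hS : ExchangeStarOn V q) :
    ∀ (n : ℕ) (w : Sym2 V → unitInterval) (x z : V), (undet (Function.update w s(x, z) 0)).card = n →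
      ∀ (𝒰 : Set (Set V)), IsUpperSet 𝒰 →
        (rcMeasureW (Function.update w s(x, z) 0) q ∅).real (clusterIn x 𝒰) ≤
          (rcMeasureW (Function.update w s(x, z) 1) q ∅).real (clusterIn x 𝒰) := by
  intro n
  induction n using Nat.strong_induction_on with
  | _ n ih =>
    intro w x z hn 𝒰 h𝒰
    by_cases hfar : ∃ g ∈ undet (Function.update w s(x, z) 0),
        ∀ y ∈ g, ¬ (openGraph (oneSet (Function.update w s(x, z) 0))).Reachable x y
    · -- a far undetermined pair: FAR exchange inequality
      obtain ⟨g, hgu, hgfar⟩ := hfar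
      exact mm_of_exchIneq hq0 w x z g 𝒰 hgu
        (ih _ (hn ▸ card_undet_reveal_lt w x z hgu 1 (Or.inr rfl)) _ x z rfl 𝒰 h𝒰)
        (ih _ (hn ▸ card_undet_reveal_lt w x z hgu 0 (Or.inl rfl)) _ x z rfl 𝒰 h𝒰)
        (hF w x z g 𝒰 h𝒰 hgfar)
    · push Not at hfar
      -- every undetermined pair meets the weight-1 cluster of `x`
      by_cases hany : ∃ g, g ∈ undet (Function.update w s(x, z) 0)
      · obtain ⟨g, hgu⟩ := hany
        exact mm_of_exchIneq hq0 w x z g 𝒰 hgu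
          (ih _ (hn ▸ card_undet_reveal_lt w x z hgu 1 (Or.inr rfl)) _ x z rfl 𝒰 h𝒰)
          (ih _ (hn ▸ card_undet_reveal_lt w x z hgu 0 (Or.inl rfl)) _ x z rfl 𝒰 h𝒰)
          (hS w x z g 𝒰 h𝒰 hfar hgu)
      · -- base case: no undetermined pair at all in `w[f ↦ 0]`
        push Not at hany
        have hA : ∀ g ∈ cut {x} (oneSet (Function.update w s(x, z) 0)),
            Function.update w s(x, z) 0 g = 0 ∨ Function.update w s(x, z) 0 g = 1 := fun g _ => by
          have := hany g; rw [mem_undet_iff] at this; push Not at this; exact this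
        rw [real_clusterIn_of_determined _ hq0 x hA 𝒰]
        by_cases hin : openCluster (oneSet (Function.update w s(x, z) 0)) x ∈ 𝒰
        · rw [ind_of_mem hin]
          have h1 : (rcMeasureW (Function.update w s(x, z) 1) q ∅).real (clusterIn x 𝒰) = 1 := by
            rw [real_eq_rcE_ind _ hq0, ← rcE_one (Function.update w s(x, z) 1) hq0]
            refine rcE_congr_support _ q fun ω hω => ?_
            have hsub : oneSet (Function.update w s(x, z) 0) ⊆ ω := fun e he =>
              (mem_of_rcMass_ne_zero _ q hω).1 e (oneSet_update_zero_subset w s(x, z) he)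
            have hmono : openCluster (oneSet (Function.update w s(x, z) 0)) x ⊆ openCluster ω x :=
              fun y hy => hy.mono (openGraph_le hsub)
            exact ind_of_mem (show ω ∈ clusterIn x 𝒰 from h𝒰 hmono hin)
          rw [h1]
        · rw [ind_of_not_mem hin]; exact measureReal_nonneg

/-- **FAR ∧ STAR ⇒ MM** on the vertex type `V` (every `q > 0`). [cite: Grimmett2006, Thm. (3.7) (p. 39); §3.9 (pp. 63–65)] -/
theorem clusterDomAdjOn_of_exchangeFar_star {q : ℝ} (hq0 : 0 < q) (hF : ExchangeFarOn V q) (hS : ExchangeStarOn V q) :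
    ClusterDomAdjOn V q :=
  fun w x z 𝒰 h𝒰 => clusterDomAdj_of_exchangeFar_star_aux hq0 hF hS _ w x z rfl 𝒰 h𝒰

/-- **Conjecture nodes: `ExchangeFarFKPos ∧ ExchangeStarFKPos → ClusterDomAdjFKPos`** (hence → `ClusterAssocFKPos`, `HubFKPos`,
`EdgeNegCorrAdjFKLtOne`, `HubCovBoundFKLtOne`). [cite: Grimmett2006, §3.9 (pp. 63–65)] [cite: AyyerLinussonRavichandran2025, §7 eq. (13), Conj. 7.1 (p. 22)] -/
theorem clusterDomAdjFKPos_of_exchangeFar_star (hF : ExchangeFarFKPos) (hS : ExchangeStarFKPos) : ClusterDomAdjFKPos :=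
  fun q hq0 n => clusterDomAdjOn_of_exchangeFar_star hq0 (hF q hq0 n) (hS q hq0 n)

/-- `ExchangeFarFKPos ∧ ExchangeStarFKPos → HubFKPos` (Ayyer–Linusson–Ravichandran (13)/(15) for every `q > 0`).
[cite: AyyerLinussonRavichandran2025, §7 eq. (13), Conj. 7.1 (p. 22)] -/
theorem hubFKPos_of_exchangeFar_star (hF : ExchangeFarFKPos) (hS : ExchangeStarFKPos) : HubFKPos :=
  hubFKPos_of_clusterDomAdjFKPos (clusterDomAdjFKPos_of_exchangeFar_star hF hS)

/-- `ExchangeFarFKPos ∧ ExchangeStarFKPos → EdgeNegCorrAdjFKLtOne`. [cite: Grimmett2006, §3.9 eq. (3.94) (p. 63)] -/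
theorem edgeNegCorrAdjFKLtOne_of_exchangeFar_star (hF : ExchangeFarFKPos) (hS : ExchangeStarFKPos) : EdgeNegCorrAdjFKLtOne :=
  edgeNegCorrAdjFKLtOne_of_clusterDomAdjFKPos (clusterDomAdjFKPos_of_exchangeFar_star hF hS)

end FK

end Summit.CriticalPhenomena.PercolationContinuityZ3.Theorems

end
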